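import Mathlib.NumberTheory.NumberField.Discriminant.Defs
import Mathlib.Analysis.Polynomial.MahlerMeasure
import Mathlib.RingTheory.Polynomial.IntegralNormalization
import Mathlib.RingTheory.Ideal.Norm.AbsNorm
import Literature.NumberTheory.LFunctions.DegreeOnePrimesTailOrder
import HarnessLib

/-!
# The field discriminant of `ℚ[X]/(g)` is small, and prime-norm ideals give roots of `g` mod `p`

Topic `Literature/NumberTheory/LFunctions`, grouping namespace `DegreeOnePrimes`; bricks 2 and 3
(`…DiscriminantBound`, `…ScaledRoot`) announced in `DegreeOnePrimesTailOrder.lean`, over its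
`RootField g = AdjoinRoot (g ⊗ ℚ)`, `powFamily g`, `tailFamily g`, `tailDiscr g`. Everything in
this file is PROVED (no named facts).

Let `g = a_d Y^d + … + a_0 ∈ ℤ[Y]` be irreducible over `ℚ` (not necessarily monic), `K = ℚ[Y]/(g)`
its stem field with root `y`, and `W ≥ ∑ |a_i|` a real bound for the weight. We prove the two facts
about `K` that the effective Chebotarev/prime-ideal theorem needs in Bürgisser's proof of
`VP = VNP ⟹ P/poly = NP/poly` (TCS 235 (2000), §4.2, p. 84; consumer
`Literature/Computability/AlgebraicComplexity/BurgisserRootCountGRH.lean`):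

* `abs_discr_rootField_le`, `log_abs_discr_rootField_le` — **the field discriminant is small**:
  `|d_K| ≤ d^d · W^{2d}`, i.e. `log |d_K| ≤ d log d + 2 d log W` (Bürgisser, p. 84: "if `w` is an
  upper bound on the weight of `g`, then we have the estimate `log |Δ| = O(d log(dw))` for the
  discriminant `Δ`" — there for `Δ = disc(g)`; we bound `d_K ∣ D_g = disc(tailFamily)` directly);
* `exists_root_mod_of_absNorm_eq` — **ideals of prime norm give roots modulo `p`**: if `𝓞 K` has
  an ideal of norm `p` with `p ∤ a_d`, then `g` has a root in `ℤ/pℤ` (the easy half of the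
  Dedekind–Kummer correspondence, valid at *every* prime `p ∤ a_d`, no conductor condition).

## Proofs

* `disc(1, y, …, y^{d-1}) = ± N_{K/ℚ}(g₁'(y)) · a_d^{-d}` with `g₁ = g/a_d` the minimal polynomial
  (`Algebra.discr_powerBasis_eq_norm`), `N(g₁'(y)) = ∏_σ g₁'(σ y)` over the `d` embeddings
  `σ : K → ℂ` (`Algebra.norm_eq_prod_embeddings`), `|g'(z)| ≤ d W max(1,|z|)^{d-1}`, and
  `∏_σ max(1, |σ y|) = M(g)/|a_d| ≤ W/|a_d|` by Mathlib's Landau–Mahler inequality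
  `Polynomial.mahlerMeasure_le_sum_norm_coeff` (the `σ y` are the complex roots of `g`,
  `PowerBasis.liftEquiv'`). With `disc(b) = a_d^{2d} disc(1, y, …)` (`discr_tailFamily`) this gives
  `|D_g| = |a_d|^d |N(g₁'(y))| ≤ |a_d| (dW)^d W^{d-1} ≤ d^d W^{2d}`, and `d_K ∣ D_g ≠ 0`
  (`discr_dvd_tailDiscr`).
* Roots modulo `p`: `a_d y ∈ 𝓞 K` is a root of Mathlib's `integralNormalization g`; reduce it
  modulo an ideal of norm `p` (quotient `≅ ℤ/pℤ`) and use
  `integralNormalization g (a_d t) = a_d^{d-1} g(t)`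
  (`Polynomial.integralNormalization_eval₂_leadingCoeff_mul`).

## Design choices

* The power basis `rootPB g = AdjoinRoot.powerBasis _` is needed as such (for
  `discr_powerBasis_eq_norm`, `liftEquiv'`, `algHom_ext`); `discr ℚ (powFamily g)` is its
  discriminant reindexed (`powFamily_eq_basis_comp`). Mathlib's two `ℚ`-algebra structures on
  `RootField g` (`AdjoinRoot.instAlgebra`, `DivisionRing.toRatAlgebra`) are definitionally equal;
  `minpoly_rootPB_gen` transports `AdjoinRoot.minpoly_root` across them.
* The weight enters only through a real bound `W ≥ ∑_{i ≤ d} |a_i|`.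
* Mathlib has the Mahler measure, `Algebra.discr`, `NumberField.discr`, `integralNormalization`,
  but no discriminant bounds for stem fields and no roots-mod-`p` statement for non-monic
  generators (searched `mahlerMeasure` in Literature, `abs_discr`, `discr_le`,
  `integralNormalization` + `RingOfIntegers`).

## References

* P. Bürgisser, *Cook's versus Valiant's hypothesis*, Theoret. Comput. Sci. 235 (2000) 71–88,
  §4.2, p. 84 (`Burgisser2000TCS`).
* K. Mahler, *An application of Jensen's formula to polynomials*, Mathematika 7 (1960) 98–100
  (`M(g) ≤ ‖g‖₁`; Mathlib `Polynomial.mahlerMeasure_le_sum_norm_coeff`). [folklore]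
-/

noncomputable section

open Polynomial NumberField

namespace Literature.NumberTheory.LFunctions

namespace DegreeOnePrimes

variable (g : ℤ[X]) [Fact (Irreducible (g.map (algebraMap ℤ ℚ)))]

set_option hygiene false in
/-- The distinguished root `y` of `g` in `K_g = RootField g` (notation local to this file). -/
local notation "θ" => (AdjoinRoot.root (Polynomial.map (algebraMap ℤ ℚ) g) : RootField g)

/-! ### The power basis of `K_g` and its relation to `powFamily` -/

/-- The power basis `1, y, …, y^{deg g - 1}` of `K_g` as a Mathlib `PowerBasis`
(`AdjoinRoot.powerBasis`). [folklore] -/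
def rootPB : PowerBasis ℚ (RootField g) := AdjoinRoot.powerBasis (map_rat_ne_zero g)

/-- The generator of `rootPB g` is the root `y`. [folklore] -/
theorem rootPB_gen : (rootPB g).gen = θ := rfl

/-- `dim (rootPB g) = deg g`. [folklore] -/
theorem rootPB_dim : (rootPB g).dim = g.natDegree := natDegree_map_rat g

/-- `disc_ℚ(powFamily g) = disc_ℚ(rootPB g)` (reindexing). [folklore] -/
theorem discr_powFamily_eq : Algebra.discr ℚ (powFamily g) = Algebra.discr ℚ ⇑(rootPB g).basis := by
  rw [powFamily_eq_basis_comp, Algebra.discr_reindex]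
  rfl

omit [Fact (Irreducible (g.map (algebraMap ℤ ℚ)))] in
/-- The leading coefficient of `g ⊗ ℚ` is `a_d`. [folklore] -/
theorem leadingCoeff_map_rat :
    (g.map (algebraMap ℤ ℚ)).leadingCoeff = (g.leadingCoeff : ℚ) := by
  rw [leadingCoeff_map_of_injective (algebraMap ℤ ℚ).injective_int, eq_intCast]

/-! ### Analytic bounds: the derivative at the conjugates and the Mahler measure -/

section Analytic

open Finset

variable {g}

omit [Fact (Irreducible (g.map (algebraMap ℤ ℚ)))] in
/-- `∑_{i<d} |a_{i+1}| ≤ ∑_{i ≤ d} |a_i|`. [folklore] -/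
theorem sum_abs_coeff_succ_le {W : ℝ}
    (hW : ∑ i ∈ range (g.natDegree + 1), |(g.coeff i : ℝ)| ≤ W) :
    ∑ i ∈ range g.natDegree, |(g.coeff (i + 1) : ℝ)| ≤ W := by
  refine le_trans ?_ hW
  rw [sum_range_succ' (fun i => |(g.coeff i : ℝ)|)]
  exact le_add_of_nonneg_right (abs_nonneg _)

omit [Fact (Irreducible (g.map (algebraMap ℤ ℚ)))] in
/-- `|a_d| ≤ ∑_{i ≤ d} |a_i|`. [folklore] -/
theorem abs_leadingCoeff_le {W : ℝ}
    (hW : ∑ i ∈ range (g.natDegree + 1), |(g.coeff i : ℝ)| ≤ W) :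
    |(g.leadingCoeff : ℝ)| ≤ W := by
  refine le_trans ?_ hW
  rw [leadingCoeff]
  exact single_le_sum (f := fun i => |(g.coeff i : ℝ)|) (fun i _ => abs_nonneg _)
    (mem_range.mpr (Nat.lt_succ_self _))

/-- **`|g'(z)| ≤ d · W · max(1, |z|)^{d-1}`** for `z ∈ ℂ`, `d = deg g`, `W ≥ ∑ |a_i|`. [folklore] -/
theorem norm_aeval_derivative_le {W : ℝ}
    (hW : ∑ i ∈ range (g.natDegree + 1), |(g.coeff i : ℝ)| ≤ W) (z : ℂ) :
    ‖aeval z (derivative g)‖ ≤ g.natDegree * W * max 1 ‖z‖ ^ (g.natDegree - 1) := by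
  set d := g.natDegree with hd_def
  set M := max 1 ‖z‖ with hM_def
  have hM : 1 ≤ M := le_max_left _ _
  have hd : 0 < d := rootField_natDegree_pos g
  have hdeg : (derivative g).natDegree < d :=
    lt_of_le_of_lt (natDegree_derivative_le g) (Nat.sub_lt hd one_pos)
  rw [aeval_eq_sum_range' hdeg]
  calc ‖∑ i ∈ range d, (derivative g).coeff i • z ^ i‖
      ≤ ∑ i ∈ range d, |(g.coeff (i + 1) : ℝ)| * (d * M ^ (d - 1)) :=
        norm_sum_le_of_le _ fun i hi => ?_
    _ = (∑ i ∈ range d, |(g.coeff (i + 1) : ℝ)|) * (d * M ^ (d - 1)) := by rw [sum_mul]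
    _ ≤ W * (d * M ^ (d - 1)) :=
        mul_le_mul_of_nonneg_right (sum_abs_coeff_succ_le hW) (by positivity)
    _ = d * W * M ^ (d - 1) := by ring
  have hi' : i < d := mem_range.mp hi
  rw [Algebra.smul_def, eq_intCast, coeff_derivative, norm_mul, norm_pow, Int.cast_mul,
    norm_mul, Complex.norm_intCast]
  have h1 : ‖(((i : ℤ) + 1 : ℤ) : ℂ)‖ = (i : ℝ) + 1 := by
    rw [Complex.norm_intCast]
    push_cast
    exact abs_of_nonneg (by positivity)
  rw [h1]
  have h2 : (i : ℝ) + 1 ≤ d := by exact_mod_cast hi'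
  have h3 : ‖z‖ ^ i ≤ M ^ (d - 1) :=
    le_trans (pow_le_pow_left₀ (norm_nonneg _) (le_max_right _ _) i)
      (pow_le_pow_right₀ hM (by omega))
  have h4 : 0 ≤ |((g.coeff (i + 1) : ℤ) : ℝ)| := abs_nonneg _
  calc |((g.coeff (i + 1) : ℤ) : ℝ)| * ((i : ℝ) + 1) * ‖z‖ ^ i
      ≤ |((g.coeff (i + 1) : ℤ) : ℝ)| * d * M ^ (d - 1) := by gcongr
    _ = _ := by ring

/-! ### The conjugates of `y` are the complex roots of `g`; their Mahler product -/

variable (g)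

omit [Fact (Irreducible (g.map (algebraMap ℤ ℚ)))] in
/-- `g` over `ℂ`, through `ℚ`. [folklore] -/
theorem map_map_complex :
    (g.map (algebraMap ℤ ℚ)).map (algebraMap ℚ ℂ) = g.map (Int.castRingHom ℂ) := by
  rw [Polynomial.map_map, RingHom.ext_int ((algebraMap ℚ ℂ).comp (algebraMap ℤ ℚ))
    (Int.castRingHom ℂ)]

/-- The minimal polynomial of `y` over `ℚ` is `g / a_d` (Mathlib's `AdjoinRoot.minpoly_root`,
transported along the (definitionally equal) `ℚ`-algebra structures on the stem field). [folklore] -/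
theorem minpoly_rootPB_gen :
    minpoly ℚ (rootPB g).gen =
      g.map (algebraMap ℤ ℚ) * C ((g.map (algebraMap ℤ ℚ)).leadingCoeff)⁻¹ :=
  AdjoinRoot.minpoly_root (map_rat_ne_zero g)

/-- The complex roots of the minimal polynomial of `y` are the complex roots of `g`. [folklore] -/
theorem aroots_minpoly_eq :
    (minpoly ℚ (rootPB g).gen).aroots ℂ = (g.map (Int.castRingHom ℂ)).roots := by
  have ha : (g.map (algebraMap ℤ ℚ)).leadingCoeff ≠ 0 :=
    Polynomial.leadingCoeff_ne_zero.mpr (map_rat_ne_zero g)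
  rw [minpoly_rootPB_gen, aroots_def, Polynomial.map_mul, map_C, map_map_complex, mul_comm,
    roots_C_mul]
  rw [map_inv₀]
  exact inv_ne_zero ((map_ne_zero_iff _ (algebraMap ℚ ℂ).injective).mpr ha)

/-- The complex roots of `g` are simple (`g` is irreducible over `ℚ`). [folklore] -/
theorem nodup_roots_complex : (g.map (Int.castRingHom ℂ)).roots.Nodup := by
  rw [← map_map_complex]
  exact nodup_roots ((Fact.out : Irreducible (g.map (algebraMap ℤ ℚ))).separable.map)

/-- **Products over the embeddings `σ : K → ℂ` are products over the complex roots of `g`**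
(`σ ↦ σ(y)` is a bijection onto the roots; `PowerBasis.liftEquiv'`). [folklore] -/
theorem prod_embeddings_eq_prod_roots {M : Type*} [CommMonoid M] (f : ℂ → M) :
    ∏ σ : RootField g →ₐ[ℚ] ℂ, f (σ θ) = ((g.map (Int.castRingHom ℂ)).roots.map f).prod := by
  classical
  set S := (g.map (Int.castRingHom ℂ)).roots with hS_def
  have hmem : ∀ σ : RootField g →ₐ[ℚ] ℂ, σ θ ∈ S := fun σ => by
    have h := ((rootPB g).liftEquiv' σ).2
    rw [PowerBasis.liftEquiv'_apply_coe, aroots_minpoly_eq] at h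
    exact h
  have hval : S.toFinset.val = S := by
    rw [Multiset.toFinset_val, (nodup_roots_complex g).dedup]
  rw [← hval, ← Finset.prod_eq_multiset_prod]
  refine Finset.prod_nbij (fun σ => σ θ) (fun σ _ => Multiset.mem_toFinset.mpr (hmem σ))
    (fun σ _ τ _ h => (rootPB g).algHom_ext h) (fun z hz => ?_) (fun σ _ => rfl)
  have hz' : z ∈ (minpoly ℚ (rootPB g).gen).aroots ℂ := by
    rw [aroots_minpoly_eq]
    exact Multiset.mem_toFinset.mp hz
  refine ⟨(rootPB g).liftEquiv'.symm ⟨z, hz'⟩, Finset.mem_coe.mpr (Finset.mem_univ _), ?_⟩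
  have := congrArg Subtype.val ((rootPB g).liftEquiv'.apply_symm_apply ⟨z, hz'⟩)
  rwa [PowerBasis.liftEquiv'_apply_coe] at this

variable {g}

omit [Fact (Irreducible (g.map (algebraMap ℤ ℚ)))] in
/-- The `ℓ¹`-norm of the coefficients of `g` over `ℂ` is at most `∑ |a_i|`. [folklore] -/
theorem sum_norm_coeff_le {W : ℝ}
    (hW : ∑ i ∈ range (g.natDegree + 1), |(g.coeff i : ℝ)| ≤ W) :
    ((g.map (Int.castRingHom ℂ)).sum fun _ c => ‖c‖) ≤ W := by
  refine le_trans ?_ hW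
  rw [Polynomial.sum_def]
  have hsub : (g.map (Int.castRingHom ℂ)).support ⊆ range (g.natDegree + 1) :=
    supp_subset_range_natDegree_succ.trans
      (range_mono (Nat.succ_le_succ natDegree_map_le))
  refine le_trans (le_of_eq (sum_congr rfl fun n _ => ?_))
    (sum_le_sum_of_subset_of_nonneg hsub fun i _ _ => abs_nonneg _)
  rw [coeff_map, eq_intCast, Complex.norm_intCast]

/-- **Landau–Mahler**: `∏_{g(z)=0} max(1, |z|) = M(g)/|a_d| ≤ (∑ |a_i|)/|a_d|`
(Mathlib's `mahlerMeasure_le_sum_norm_coeff`). [folklore] -/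
theorem prod_max_one_norm_roots_le {W : ℝ}
    (hW : ∑ i ∈ range (g.natDegree + 1), |(g.coeff i : ℝ)| ≤ W) :
    ((g.map (Int.castRingHom ℂ)).roots.map fun z => max 1 ‖z‖).prod ≤
      W / |(g.leadingCoeff : ℝ)| := by
  set gc := g.map (Int.castRingHom ℂ) with hgc
  have hlc : gc.leadingCoeff = (g.leadingCoeff : ℂ) :=
    leadingCoeff_map_of_injective (RingHom.injective_int _) _
  have ha : 0 < |(g.leadingCoeff : ℝ)| :=
    abs_pos.mpr (Int.cast_ne_zero.mpr (Polynomial.leadingCoeff_ne_zero.mpr (ne_zero_of_fact_irreducible g)))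
  rw [le_div_iff₀ ha]
  calc (gc.roots.map fun z => max 1 ‖z‖).prod * |(g.leadingCoeff : ℝ)|
      = ‖gc.leadingCoeff‖ * (gc.roots.map fun z => max 1 ‖z‖).prod := by
        rw [hlc, Complex.norm_intCast, mul_comm]
    _ = gc.mahlerMeasure := (mahlerMeasure_eq_leadingCoeff_mul_prod_roots gc).symm
    _ ≤ gc.sum fun _ c => ‖c‖ := mahlerMeasure_le_sum_norm_coeff gc
    _ ≤ W := sum_norm_coeff_le hW

/-- `∏_σ max(1, |σ(y)|) ≤ W / |a_d|` over the embeddings `σ : K → ℂ`. [folklore] -/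
theorem prod_max_one_norm_embedding_le {W : ℝ}
    (hW : ∑ i ∈ range (g.natDegree + 1), |(g.coeff i : ℝ)| ≤ W) :
    ∏ σ : RootField g →ₐ[ℚ] ℂ, max 1 ‖σ θ‖ ≤ W / |(g.leadingCoeff : ℝ)| := by
  rw [prod_embeddings_eq_prod_roots g (fun z => max 1 ‖z‖)]
  exact prod_max_one_norm_roots_le hW

/-! ### The norm of `g'(y)` and the discriminant bound -/

/-- `σ(g₁'(y)) = g'(σ(y))` for an embedding `σ : K → ℂ` (`g₁ = g ⊗ ℚ`). [folklore] -/
theorem embedding_aeval_derivative (σ : RootField g →ₐ[ℚ] ℂ) :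
    σ (aeval θ (derivative (g.map (algebraMap ℤ ℚ)))) = aeval (σ θ) (derivative g) := by
  rw [← aeval_algHom_apply, derivative_map, aeval_map_algebraMap]

/-- The number of embeddings `K → ℂ` is `deg g`. [folklore] -/
theorem card_embeddings :
    Fintype.card (RootField g →ₐ[ℚ] ℂ) = g.natDegree := by
  rw [AlgHom.card, finrank_rootField]

/-- **`|N_{K/ℚ}(g₁'(y))| ≤ (dW)^d (W/|a_d|)^{d-1}`**: the norm is the product of the `g'(σ y)`
over the `d` embeddings (`Algebra.norm_eq_prod_embeddings`), each bounded by
`norm_aeval_derivative_le`, and `∏_σ max(1,|σ y|) ≤ W/|a_d|` (`prod_max_one_norm_embedding_le`).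
[folklore] -/
theorem abs_norm_aeval_derivative_le {W : ℝ}
    (hW : ∑ i ∈ range (g.natDegree + 1), |(g.coeff i : ℝ)| ≤ W) :
    |(Algebra.norm ℚ (aeval θ (derivative (g.map (algebraMap ℤ ℚ)))) : ℝ)| ≤
      (g.natDegree * W) ^ g.natDegree *
        (W / |(g.leadingCoeff : ℝ)|) ^ (g.natDegree - 1) := by
  set u := aeval θ (derivative (g.map (algebraMap ℤ ℚ))) with hu
  set d := g.natDegree with hd
  have hnorm : ((Algebra.norm ℚ u : ℚ) : ℂ) = ∏ σ : RootField g →ₐ[ℚ] ℂ, σ u :=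
    Algebra.norm_eq_prod_embeddings ℚ ℂ u
  have habs : |(Algebra.norm ℚ u : ℝ)| = ‖((Algebra.norm ℚ u : ℚ) : ℂ)‖ := by
    rw [Complex.norm_ratCast]
  have hW0 : 0 ≤ W := le_trans (abs_nonneg _) (abs_leadingCoeff_le hW)
  rw [habs, hnorm, norm_prod]
  have h1 : ∀ σ : RootField g →ₐ[ℚ] ℂ, ‖σ u‖ ≤ d * W * max 1 ‖σ θ‖ ^ (d - 1) := by
    intro σ
    rw [hu, embedding_aeval_derivative]
    exact norm_aeval_derivative_le hW _
  have hprod : 0 ≤ ∏ σ : RootField g →ₐ[ℚ] ℂ, max 1 ‖σ θ‖ :=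
    prod_nonneg fun σ _ => le_trans zero_le_one (le_max_left _ _)
  calc ∏ σ : RootField g →ₐ[ℚ] ℂ, ‖σ u‖
      ≤ ∏ σ : RootField g →ₐ[ℚ] ℂ, (d * W * max 1 ‖σ θ‖ ^ (d - 1)) :=
        prod_le_prod (fun σ _ => norm_nonneg _) fun σ _ => h1 σ
    _ = (d * W) ^ d * (∏ σ : RootField g →ₐ[ℚ] ℂ, max 1 ‖σ θ‖) ^ (d - 1) := by
        rw [prod_mul_distrib, prod_const, prod_pow, card_univ, card_embeddings]
    _ ≤ (d * W) ^ d * (W / |(g.leadingCoeff : ℝ)|) ^ (d - 1) :=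
        mul_le_mul_of_nonneg_left
          (pow_le_pow_left₀ hprod (prod_max_one_norm_embedding_le hW) _)
          (pow_nonneg (mul_nonneg (Nat.cast_nonneg _) hW0) _)

/-- **`|disc(1, y, …, y^{d-1})| = |N(g₁'(y))| · |a_d|^{-d}`** (`Algebra.discr_powerBasis_eq_norm`
with `minpoly y = g₁ / a_d`), for the power family `powFamily g`. [folklore] -/
theorem abs_discr_powFamily_eq :
    |(Algebra.discr ℚ (powFamily g) : ℝ)| =
      |(Algebra.norm ℚ (aeval θ (derivative (g.map (algebraMap ℤ ℚ)))) : ℝ)| *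
        |(g.leadingCoeff : ℝ)|⁻¹ ^ g.natDegree := by
  have h := Algebra.discr_powerBasis_eq_norm ℚ (rootPB g)
  rw [minpoly_rootPB_gen, derivative_mul, derivative_C, mul_zero, add_zero, aeval_mul, aeval_C,
    map_mul, Algebra.norm_algebraMap, finrank_rootField, rootPB_gen, leadingCoeff_map_rat] at h
  rw [discr_powFamily_eq, h]
  push_cast
  rw [abs_mul, abs_mul, abs_pow, abs_pow, abs_neg, abs_one, one_pow, one_mul, abs_inv]

/-- **`|D_g| = |disc(b_0, …, b_{d-1})| ≤ d^d · W^{2d}`** for the tail family of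
`DegreeOnePrimesTailOrder.lean`. [folklore] -/
theorem abs_discr_tailFamily_le {W : ℝ}
    (hW : ∑ i ∈ range (g.natDegree + 1), |(g.coeff i : ℝ)| ≤ W) :
    |(Algebra.discr ℚ (tailFamily g) : ℝ)| ≤
      (g.natDegree : ℝ) ^ g.natDegree * W ^ (2 * g.natDegree) := by
  set d := g.natDegree with hd
  set A := |(g.leadingCoeff : ℝ)| with hA
  have hApos : 0 < A := abs_pos.mpr (Int.cast_ne_zero.mpr (Polynomial.leadingCoeff_ne_zero.mpr (ne_zero_of_fact_irreducible g)))
  have hAW : A ≤ W := abs_leadingCoeff_le hW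
  have hW0 : 0 ≤ W := hApos.le.trans hAW
  have hdpos : 0 < d := rootField_natDegree_pos g
  have hN := abs_norm_aeval_derivative_le hW
  set N := |(Algebra.norm ℚ (aeval θ (derivative (g.map (algebraMap ℤ ℚ)))) : ℝ)| with hN_def
  have hN0 : 0 ≤ N := abs_nonneg _
  have hdiscr : |(Algebra.discr ℚ (tailFamily g) : ℝ)| = A ^ d * N := by
    rw [discr_tailFamily]
    push_cast
    rw [abs_mul, abs_pow, abs_pow, abs_discr_powFamily_eq, ← hA, ← hN_def, ← hd, inv_pow,
      show (A ^ d) ^ 2 * (N * (A ^ d)⁻¹) = (A ^ d * (A ^ d)⁻¹) * (A ^ d * N) by ring,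
      mul_inv_cancel₀ (pow_ne_zero _ hApos.ne'), one_mul]
  have hd1 : d = (d - 1) + 1 := (Nat.sub_add_cancel hdpos).symm
  have hAd : A ^ d = A * A ^ (d - 1) := by
    conv_lhs => rw [hd1]
    exact pow_succ' A (d - 1)
  have hWd : W ^ d = W * W ^ (d - 1) := by
    conv_lhs => rw [hd1]
    exact pow_succ' W (d - 1)
  calc |(Algebra.discr ℚ (tailFamily g) : ℝ)| = A ^ d * N := hdiscr
    _ ≤ A ^ d * ((d * W) ^ d * (W / A) ^ (d - 1)) := by gcongr
    _ = (d * W) ^ d * A * (A * (W / A)) ^ (d - 1) := by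
        rw [mul_pow A (W / A), hAd]
        ring
    _ = (d * W) ^ d * A * W ^ (d - 1) := by rw [mul_div_cancel₀ W hApos.ne']
    _ ≤ (d * W) ^ d * W * W ^ (d - 1) := by gcongr
    _ = (d : ℝ) ^ d * W ^ (2 * d) := by
        rw [mul_assoc, ← hWd, mul_pow, two_mul, pow_add]
        ring

/-- `|d_{K_g}| ≤ |D_g|` in `ℝ`: the field discriminant divides the nonzero integer
`D_g = disc(tailFamily g)` (`discr_dvd_tailDiscr`, `tailDiscr_ne_zero`). [folklore] -/
theorem abs_discr_rootField_le_abs_discr_tailFamily :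
    |(NumberField.discr (RootField g) : ℝ)| ≤ |(Algebra.discr ℚ (tailFamily g) : ℝ)| := by
  have hdvd := discr_dvd_tailDiscr g
  have hne := tailDiscr_ne_zero g
  have h1 : (NumberField.discr (RootField g)).natAbs ≤ (tailDiscr g).natAbs :=
    Int.natAbs_le_of_dvd_ne_zero hdvd hne
  have h2 : ((Algebra.discr ℚ (tailFamily g) : ℚ) : ℝ) = ((tailDiscr g : ℤ) : ℝ) := by
    rw [← cast_tailDiscr, Rat.cast_intCast]
  rw [h2, ← Int.cast_abs, ← Int.cast_abs, Int.abs_eq_natAbs, Int.abs_eq_natAbs]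
  exact_mod_cast h1

/-- **The discriminant of the stem field of `g` is at most `d^d W^{2d}`** in absolute value, for
`g ∈ ℤ[X]` irreducible over `ℚ` of degree `d` with `∑ |a_i| ≤ W` (Bürgisser 2000 TCS, p. 84:
"if `w` is an upper bound on the weight of `g`, then we have the estimate
`log |Δ| = O(d log(dw))` for the discriminant `Δ`"; here for the field discriminant `d_K`, which
is what enters the effective Chebotarev bounds, via `d_K ∣ D_g` and the Landau–Mahler
inequality). [cite: Burgisser2000TCS, §4.2 p. 84] -/
theorem abs_discr_rootField_le {W : ℝ}
    (hW : ∑ i ∈ range (g.natDegree + 1), |(g.coeff i : ℝ)| ≤ W) :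
    |(NumberField.discr (RootField g) : ℝ)| ≤
      (g.natDegree : ℝ) ^ g.natDegree * W ^ (2 * g.natDegree) :=
  abs_discr_rootField_le_abs_discr_tailFamily.trans (abs_discr_tailFamily_le hW)

/-- **`log |d_K| ≤ d log d + 2 d log W`** for the stem field `K = ℚ[Y]/(g)` (`W` a bound for the
weight `∑ |a_i|`, automatically `≥ 1`; Bürgisser 2000 TCS, p. 84, `log |Δ| = O(d log(dw))`).
[cite: Burgisser2000TCS, §4.2 p. 84] -/
theorem log_abs_discr_rootField_le {W : ℝ}
    (hW : ∑ i ∈ range (g.natDegree + 1), |(g.coeff i : ℝ)| ≤ W) :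
    Real.log |(NumberField.discr (RootField g) : ℝ)| ≤
      g.natDegree * Real.log g.natDegree + 2 * g.natDegree * Real.log W := by
  have hpos : 0 < |(NumberField.discr (RootField g) : ℝ)| :=
    abs_pos.mpr (Int.cast_ne_zero.mpr (NumberField.discr_ne_zero _))
  have hd : 0 < (g.natDegree : ℝ) := Nat.cast_pos.mpr (rootField_natDegree_pos g)
  have hne : g.leadingCoeff ≠ 0 :=
    Polynomial.leadingCoeff_ne_zero.mpr (ne_zero_of_fact_irreducible g)
  have h1 : (1 : ℝ) ≤ |(g.leadingCoeff : ℝ)| := by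
    rw [← Int.cast_abs]
    exact_mod_cast Int.one_le_abs hne
  have hW1 : 1 ≤ W := h1.trans (abs_leadingCoeff_le hW)
  calc Real.log |(NumberField.discr (RootField g) : ℝ)|
      ≤ Real.log ((g.natDegree : ℝ) ^ g.natDegree * W ^ (2 * g.natDegree)) :=
        Real.log_le_log hpos (abs_discr_rootField_le hW)
    _ = g.natDegree * Real.log g.natDegree + 2 * g.natDegree * Real.log W := by
        rw [Real.log_mul (pow_ne_zero _ hd.ne') (pow_ne_zero _ (by linarith)), Real.log_pow,
          Real.log_pow]
        push_cast
        ring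

end Analytic

/-! ### Ideals of prime norm `p ∤ a_d` give roots of `g` modulo `p` -/

section RootsModP

/-- `a_d · y` is an algebraic integer: it is a root of the monic integer polynomial
`integralNormalization g` (Mathlib's `integralNormalization_aeval_eq_zero`). [folklore] -/
theorem isIntegral_leadingCoeff_mul_root :
    IsIntegral ℤ ((g.leadingCoeff : RootField g) * θ) := by
  have h := integralNormalization_aeval_eq_zero (aeval_root_eq_zero g)
    fun x hx => (algebraMap ℤ (RootField g)).injective_int (by rw [hx, map_zero])
  rw [eq_intCast] at h
  exact ⟨integralNormalization g, monic_integralNormalization (fun h0 => map_rat_ne_zero g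
    (by rw [h0, Polynomial.map_zero])), by rwa [← aeval_def]⟩

/-- The algebraic integer `a_d · y ∈ 𝓞 K`. [folklore] -/
def scaledRoot : 𝓞 (RootField g) :=
  ⟨(g.leadingCoeff : RootField g) * θ, isIntegral_leadingCoeff_mul_root g⟩

/-- `scaledRoot g` coerces to `a_d · y`. [folklore] -/
theorem scaledRoot_coe :
    (scaledRoot g : RootField g) = (g.leadingCoeff : RootField g) * θ := rfl

/-- `a_d · y` is a root of `integralNormalization g` in `𝓞 K`. [folklore] -/
theorem aeval_scaledRoot : aeval (scaledRoot g) (integralNormalization g) = 0 := by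
  apply RingOfIntegers.coe_injective
  rw [map_zero, ← aeval_algebraMap_apply, ← RingOfIntegers.coe_eq_algebraMap, scaledRoot_coe]
  have h := integralNormalization_aeval_eq_zero (aeval_root_eq_zero g)
    fun x hx => (algebraMap ℤ (RootField g)).injective_int (by rw [hx, map_zero])
  rwa [eq_intCast] at h

/-- **An ideal of `𝓞 K` of prime norm `p ∤ a_d` yields a root of `g` modulo `p`**: reduce
`a_d y ∈ 𝓞 K` modulo the ideal (the quotient is `𝔽_p`) to get a root `β` of
`integralNormalization g` modulo `p`, and `integralNormalization g (a_d t) = a_d^{d-1} g(t)`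
gives the root `t = β / a_d` of `g`. (The easy half of the Dedekind–Kummer correspondence between
degree-one primes and roots, valid at every prime not dividing the leading coefficient.)
[folklore] -/
theorem exists_root_mod_of_absNorm_eq {p : ℕ} (hp : p.Prime) (hpa : ¬ (p : ℤ) ∣ g.leadingCoeff)
    {I : Ideal (𝓞 (RootField g))} (hI : Ideal.absNorm I = p) :
    ∃ t : ZMod p, aeval t g = 0 := by
  haveI := Fact.mk hp
  have hI0 : Ideal.absNorm I ≠ 0 := by rw [hI]; exact hp.ne_zero
  haveI : Finite (𝓞 (RootField g) ⧸ I) := (Ideal.absNorm_ne_zero_iff I).mp hI0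
  letI : Fintype (𝓞 (RootField g) ⧸ I) := Fintype.ofFinite _
  have hcard : Fintype.card (𝓞 (RootField g) ⧸ I) = p := by
    rw [← hI, Ideal.absNorm_apply, Submodule.cardQuot_apply, Nat.card_eq_fintype_card]
  set ψ : 𝓞 (RootField g) →+* ZMod p :=
    (ZMod.ringEquivOfPrime _ hp hcard).symm.toRingHom.comp (Ideal.Quotient.mk I) with hψ
  set β : ZMod p := ψ (scaledRoot g) with hβ
  have hψint : ψ.comp (algebraMap ℤ (𝓞 (RootField g))) = Int.castRingHom (ZMod p) :=
    RingHom.ext_int _ _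
  -- `β` is a root of `integralNormalization g` modulo `p`
  have hβroot : eval₂ (Int.castRingHom (ZMod p)) β (integralNormalization g) = 0 := by
    have h := congrArg ψ (aeval_scaledRoot g)
    rwa [aeval_def, hom_eval₂, hψint, map_zero] at h
  -- `a_d ≠ 0` modulo `p`
  have ha : (g.leadingCoeff : ZMod p) ≠ 0 := by
    rwa [Ne, ZMod.intCast_zmod_eq_zero_iff_dvd]
  refine ⟨(g.leadingCoeff : ZMod p)⁻¹ * β, ?_⟩
  have key := integralNormalization_eval₂_leadingCoeff_mul (rootField_natDegree_pos g)
    (Int.castRingHom (ZMod p)) ((g.leadingCoeff : ZMod p)⁻¹ * β)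
  rw [eq_intCast, ← mul_assoc, mul_inv_cancel₀ ha, one_mul, hβroot] at key
  rw [aeval_def, algebraMap_int_eq]
  exact (mul_eq_zero.mp key.symm).resolve_left (pow_ne_zero _ ha)

end RootsModP


end DegreeOnePrimes

end Literature.NumberTheory.LFunctions

end
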